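import Literature.IUT.HodgeArakelov.Prop15iRecloseAtModelTate
import Literature.IUT.HodgeArakelov.BadPlaceSettingAtModelTateYRow
import Literature.AnabelianGeometry.EtaleTheta.Discharge.Sec2TowerRowsAtModelTateOfExtendsAlone
import HarnessLib

/-!
# [IUTchII] Prop. 1.5 (i)′ / (ii) at the [EtTh] Tate datum OF RECORD ⟸ hextParity ALONE — the F-0639 (`Cor218_iv_surjective`)
# binder of the K4 rows IUTchII:Prop1.5(i) / IUTchII:Prop1.5(ii) SUPPLIED by abc-iut-L2-t2's producer (proof-only; one term each)

S. Mochizuki, *Inter-universal Teichmüller theory II*, kurims manuscript (Dec. 2020), §1 Prop. 1.5 (i), (ii) p. 29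
[claim: Mochizuki2012, status: disputed] (IUTchII §1 Prop 1.5 (i)/(ii), kurims p.29); S. Mochizuki, *The étale theta function and
its Frobenioid-theoretic manifestations* [EtTh], Publ. RIMS **45** (2009), Cor. 2.18 (iv) p. 61 [cite: MochizukiEtTh2009, Cor 2.18 (iv) p.61].

abc-iut cell, seat abc-iut-c312-2 (gen 8), director-abc KEY row «K4R9» (C-R33 K4 RE-CLOSE of the RECLOSABLE class of
`CONE-K4-RECLOSE.tsv`): cone nodes IUTchII:Prop1.5(i) and IUTchII:Prop1.5(ii).  PROOF-ONLY: no definition, no instance, no notation,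
no `Prop` fact; nothing of another seat is edited or restated — inputs are consumed BY NAME.

DOC v2 (2026-08-27T10:2xZ, referee lane LETTER 3 (a) OBS): the Prop. 1.5 (ii) quotation restored to print's words («resulting», «all»,
marked ellipsis); statements and proofs byte-identical to v1 (p511716).

STATE OF RECORD BEFORE THIS FILE (abc-iut-w5-d162 g7 `K4-L6-IUTchII-INSTANCES.tsv`, abc-iut-L6-t1 g6 p465493).  At the Tate datum of
record (`ThetaSetting.modelχq p 1 2`, `E := etaleThetaDataχqInr p`) the closers of the two nodes —
`EtaleLevels.prop15_i'_of_cyclotomeTower` / `prop15_i'_etaleLevels` (Prop. 1.5 (i)′) and `EtaleLevels.transitionsAreIsos_modelSystem`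
(Prop. 1.5 (ii), print: «The transition morphisms of the resulting projective system … are all isomorphisms», kurims p. 29
l. 21–25; OUR typed form = `MonoThetaProjSystem.transitionsAreIsos` of the natural system) — have every [EtTh] input a THEOREM
(temp-slimness, openness of `aug`, Prop. 1.5 (iii) `prop15iii_etaleThetaDataχqInr`, the Cor. 2.18 (iv) FIBRE clause F-0638, the
`Π^tp_{Y̲̲}`-characteristic clause `isTopCharacteristic_GtpY_subgroupOf_Huu_modelχq`, the `Ẑ`-identification `hZ`) EXCEPT the
Cor. 2.18 (iv) SURJECTIVITY instances F-0639 `hsurj : ∀ M, (C.thetaEnvData (τ.modAll M) …).Cor218_iv_surjective`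
(`prop15_i'_of_cyclotomeTower_modelTate_inr_of_cor218_iv_surjective`, p465493; `transitionsAreIsos_modelSystem_modelTate_of_cor218_iv_surjective`,
p456075) — verdict «OPEN-AT-EVERY-CARRIER (BLOCKED-honest)» in w5-d162's table.  Since then abc-iut-L2-t2 (gen 13) landed
`SettingModel.thetaEnvData_cor218_iv_surjective_modAll_modelTate_inr_of_parity_alone` (p504800, `Sec2TowerRowsAtModelTateOfExtendsAlone`):
F-0639 at every `modAll` level of the record `X̲̲`-choice (`C.Huu = Huuχq`) ⟸ the DISPLAYED binder **hextParity** ALONE (= the [EtTh]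
Prop. 2.4 (i)-shape extension binder hextΔ of K4 rows Cor. 2.18 (i) / 2.19 (i) with abc-iut-f-148's parity conjunct; UNDECIDED at
the semi-synthetic model, abc-iut-L6-lead §F v1.19ec), every `p`.

THIS FILE (one term each, nothing new in mathematics): the two closers at the Tate datum of record with `hsurj` SUPPLIED by that
producer — `EtaleLevels.prop15_i'_of_cyclotomeTower_modelTate_inr_of_parity_alone` (Prop. 1.5 (i)′, tower currency, every compatible
projective systems `A`, `B`, every cusp labelling `L`, every root cocycle `f`) and
`EtaleLevels.transitionsAreIsos_modelSystem_modelTate_inr_of_parity_alone` (Prop. 1.5 (ii) for the natural system `modelSystem` over the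
`modAll` family of any cyclotome tower `τ`, `hchar` / `hZ` / `h15` THEOREMS as in p456075) — both ⟸ **hextParity ALONE**, for every
`p`, every odd prime `l` with `p ≠ 2`, `p ≠ l` and a primitive `4l`-th root of unity in `K`.
RESIDUAL OF RECORD after this file for K4 rows IUTchII:Prop1.5(i)/(ii) at the Tate datum: {hextParity} — displayed, CONDITIONAL-AT-MODEL.

HONEST FRAMING: `modelχq` is a SEMI-SYNTHETIC model of the typed [EtTh] §1 interface (not the tempered `π₁` of a curve) —
binder-discharge evidence for OUR typed rows only; F-0639 stays a FACT-policy row (assumption label by ID); hextParity is a DISPLAYED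
binder, not asserted; nothing of [IUTchII] / [EtTh] is asserted beyond the displayed statements; no side is taken on [IUTchIII]
Cor. 3.12; typed ≠ proved; conditional-at-a-model ≠ proved in print; re-closed ≠ endorsed; nothing here says abc is proved or refuted.
-/

noncomputable section

namespace Literature.IUT.HodgeArakelov

open Literature.AnabelianGeometry.EtaleTheta Literature.AnabelianGeometry.EtaleTheta.SettingModel
open Literature.AnabelianGeometry.SemiGraphs
open scoped Literature.AnabelianGeometry.EtaleTheta

namespace EtaleLevels

section ModelTateInrParity

variable (p : ℕ) [Fact p.Prime] (l : ℕ+) (hl : Odd (l : ℕ)) (hlp : (l : ℕ).Prime)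
  (C : (etaleThetaDataχqInr p).DoubleUnderline l) (hHuu : C.Huu = Huuχq p 1 2 l hl)
  (hp2 : p ≠ 2) (hpl : p ≠ l)
  (hζ : ∃ ζ : (ThetaSetting.modelχq p 1 2 even_two).K, IsPrimitiveRoot ζ (4 * l))
  {Es : Set ℕ+} (τ : (ThetaSetting.modelχq p 1 2 even_two).CyclotomeTower l Es)
  (f : contCocycles (ThetaSetting.modelχq p 1 2 even_two).toTheta (ThetaSetting.modelχq p 1 2 even_two).DeltaTheta
    C.GtpYdduu)
  (hf : f ∈ C.rootCocycles (compat_modelχq p 1 2 even_two))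
  (hextParity : ∀ γ : ↥C.Huu ≃ₜ* ↥C.Huu, ∃ Γ : PiTpχq p 1 2 ≃ₜ* PiTpχq p 1 2,
    (∀ h : C.Huu, Γ (h : PiTpχq p 1 2) = ((γ h : C.Huu) : PiTpχq p 1 2)) ∧
      (curveχq p 1 2).DeltaTemp.map Γ.toMulEquiv.toMonoidHom = (curveχq p 1 2).DeltaTemp ∧
      (levelHom 2 (Γ (SemidirectProduct.inl (gfpOf (FreeGroup.of 0)))).left).y = 0)

include hHuu hextParity in
/-- **IUTchII:Prop1.5(i)′ at the `inr`-section étale-theta datum OF RECORD of the Tate instance ⟸ hextParity ALONE** (tower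
currency): abc-iut-L6-t1's `prop15_i'_of_cyclotomeTower_modelTate_inr_of_cor218_iv_surjective` (p465493) with its only residual
`hsurj` (F-0639 at every `modAll` level) SUPPLIED by abc-iut-L2-t2's
`SettingModel.thetaEnvData_cor218_iv_surjective_modAll_modelTate_inr_of_parity_alone` (p504800).  For the record `X̲̲`-choice
(`C.Huu = Huuχq`), every cusp labelling `L`, every compatible cyclotome tower `τ`, every root cocycle `f`: any two compatible mono-theta
projective systems over the model family are compatibly isomorphic.  One term; proves nothing new in mathematics.
[claim: Mochizuki2012, status: disputed] (IUTchII §1 Prop 1.5 (i), kurims p.29) [cite: MochizukiEtTh2009, Cor 2.18 (iv) p.61] -/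
theorem prop15_i'_of_cyclotomeTower_modelTate_inr_of_parity_alone (L : C.CuspLabels)
    (A B : MonoThetaProjSystem (modelFamily C (compat_modelχq p 1 2 even_two)
      (ThetaSetting.modelχq_sec2Hyps p 1 2 even_two) hlp hp2 hpl hζ τ.modAll f hf)) :
    Literature.IUT.HodgeArakelov.Prop15_i'
      (reductions C (compat_modelχq p 1 2 even_two) (ThetaSetting.modelχq_sec2Hyps p 1 2 even_two) hlp hp2 hpl hζ
        τ.modAll f hf τ.red_modAll (isSlimGroup_PiTpχq p 1 2)) A B :=
  prop15_i'_of_cyclotomeTower_modelTate_inr_of_cor218_iv_surjective p C (compat_modelχq p 1 2 even_two)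
    (ThetaSetting.modelχq_sec2Hyps p 1 2 even_two) hlp hp2 hpl hζ τ f hf L
    (fun M => thetaEnvData_cor218_iv_surjective_modAll_modelTate_inr_of_parity_alone p hl C hHuu τ hextParity M) A B

include hHuu hextParity in
/-- **IUTchII:Prop1.5(ii) — print: «The transition morphisms of the resulting projective system … are all isomorphisms» (kurims p. 29
l. 21–25); OUR typed form `transitionsAreIsos` — for the natural system
`modelSystem` over the `modAll` family of a cyclotome tower at the Tate datum OF RECORD ⟸ hextParity ALONE**: abc-iut-w4-d030's
`transitionsAreIsos_modelSystem` with `hchar := ModelTateCarriers.isTopCharacteristic_GtpY_subgroupOf_Huu_modelχq` (abc-iut-w5-d233,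
p456075, a THEOREM at the model), `h15 := prop15iii_etaleThetaDataχqInr` (abc-iut-L2-t6), `hZ` from
`ModelCyclotomes.nonempty_lDeltaQuot_rigidData_mulEquiv_zHat` (abc-iut-w5-d236) and the F-0639 instances `hsurj` SUPPLIED by
abc-iut-L2-t2's producer (p504800).  One term; proves nothing new in mathematics.
[claim: Mochizuki2012, status: disputed] (IUTchII §1 Prop 1.5 (ii), kurims p.29) [cite: MochizukiEtTh2009, Cor 2.18 (iv) p.61] -/
theorem transitionsAreIsos_modelSystem_modelTate_inr_of_parity_alone (L : C.CuspLabels) :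
    (modelSystem C (compat_modelχq p 1 2 even_two) (ThetaSetting.modelχq_sec2Hyps p 1 2 even_two) hlp hp2 hpl hζ
      τ.modAll f hf τ.red_modAll (prop15iii_etaleThetaDataχqInr p (compat_modelχq p 1 2 even_two)) L
      (fun M => ModelCyclotomes.nonempty_lDeltaQuot_rigidData_mulEquiv_zHat C (τ.modAll M)
        (compat_modelχq p 1 2 even_two) (ThetaSetting.modelχq_sec2Hyps p 1 2 even_two)
        (prop15iii_etaleThetaDataχqInr p (compat_modelχq p 1 2 even_two)) L
        (ThetaSetting.modelχq_isEtThOrigin p 1 2 even_two) (hYcl_modelχq p 1 2 even_two) hlp.ne_zero)).transitionsAreIsos :=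
  transitionsAreIsos_modelSystem C (compat_modelχq p 1 2 even_two) (ThetaSetting.modelχq_sec2Hyps p 1 2 even_two) hlp
    hp2 hpl hζ τ.modAll f hf τ.red_modAll (prop15iii_etaleThetaDataχqInr p (compat_modelχq p 1 2 even_two)) L _
    (ModelTateCarriers.isTopCharacteristic_GtpY_subgroupOf_Huu_modelχq p 1 2 even_two C)
    (fun M => thetaEnvData_cor218_iv_surjective_modAll_modelTate_inr_of_parity_alone p hl C hHuu τ hextParity M)

end ModelTateInrParity

end EtaleLevels

end Literature.IUT.HodgeArakelov

end
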